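import Summits.NavierStokesRegularity.NavierStokesRegularity.Theorems.ExtremiserTransienceNearExtremalTransienceExtremiserLiouvilleConstantSpeedTools
import Literature.Analysis.FluidPDE.LocalHelmholtzSupBound
import HarnessLib

/-!
# Crux `ExtremiserTransience.NearExtremalTransience` (stmt-NavierStokesRegularity-21883), line `extremiser_liouville`,
# stub K1b — POINTWISE CALCULUS OF CONSTANT-SPEED FIELDS

`--supports stmt-NavierStokesRegularity-21883` (helper).  Author: prover seat `ns-el-k1b` (g2).

For a field of constant speed `‖w‖ ≡ M`:
* `inner_fderiv_apply_eq_zero_of_norm_eq` : `⟪w(x), Dw(x) h⟫ = 0` (`Dwᵀ w = 0`; in particular `Dw(x)` is singular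
  and the Bernoulli gradient `∇|w|²/2` vanishes);
* `frobeniusNormSq_fderiv_eq_neg_inner_laplacian` : `|Dw(x)|²_F = −⟪w(x), Δw(x)⟫`;
* `frobeniusNormSq_fderiv_eq_inner_curl_curl` : if moreover `div w = 0`, `|Dw(x)|²_F = ⟪w(x), curl curl w (x)⟫`, hence
  `|Dw|²_F ≤ M ‖curl ω‖` pointwise (`frobeniusNormSq_fderiv_le_mul_norm_curl_curl`) — so `Dw ∈ L⁴` as soon as `∇ω ∈ L²`.
These identities enter the dossier of the constant-speed residue of K1b.

WHAT THIS IS NOT: nothing here proves NS regularity. [folklore]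
-/

noncomputable section

open Set Filter Topology MeasureTheory Metric Function InnerProductSpace
open scoped ENNReal NNReal Topology InnerProductSpace RealInnerProductSpace ContDiff Laplacian
open Literature.Analysis.FluidPDE Literature.Analysis

namespace Summit.NavierStokesRegularity.NavierStokesRegularity.Theorems

-- the problem directory repeats the summit name (`NavierStokesRegularity/NavierStokesRegularity`)
set_option linter.dupNamespace false

namespace ExtremiserLiouville

variable {w : EuclideanSpace ℝ (Fin 3) → EuclideanSpace ℝ (Fin 3)} {M : ℝ}

/-- If `⟪f, g⟫ ≡ const` then `⟪f x, Dg(x) h⟫ + ⟪Df(x) h, g x⟫ = 0`. [folklore] -/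
theorem inner_fderiv_add_eq_zero_of_inner_const {f g : EuclideanSpace ℝ (Fin 3) → EuclideanSpace ℝ (Fin 3)} {C : ℝ}
    (hf : Differentiable ℝ f) (hg : Differentiable ℝ g) (hC : ∀ y, ⟪f y, g y⟫ = C) (x e : EuclideanSpace ℝ (Fin 3)) :
    ⟪f x, fderiv ℝ g x e⟫ + ⟪fderiv ℝ f x e, g x⟫ = 0 := by
  have h1 : HasFDerivAt (fun y => ⟪f y, g y⟫)
      ((fderivInnerCLM ℝ (f x, g x)).comp ((fderiv ℝ f x).prod (fderiv ℝ g x))) x :=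
    (hf x).hasFDerivAt.inner ℝ (hg x).hasFDerivAt
  have h2 : HasFDerivAt (fun y => ⟪f y, g y⟫) (0 : EuclideanSpace ℝ (Fin 3) →L[ℝ] ℝ) x := by
    have : (fun y => ⟪f y, g y⟫) = fun _ => C := funext hC
    rw [this]
    exact hasFDerivAt_const _ _
  have h := congrArg (fun L : EuclideanSpace ℝ (Fin 3) →L[ℝ] ℝ => L e) (h1.unique h2)
  have happ : ((fderivInnerCLM ℝ (f x, g x)).comp ((fderiv ℝ f x).prod (fderiv ℝ g x))) e =
      ⟪f x, fderiv ℝ g x e⟫ + ⟪fderiv ℝ f x e, g x⟫ := by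
    rw [ContinuousLinearMap.comp_apply, fderivInnerCLM_apply]
    rfl
  simp only [happ] at h
  exact h

/-- **`Dwᵀ w = 0` for a constant-speed field**: `⟪w(x), Dw(x) h⟫ = 0`. [folklore] -/
theorem inner_fderiv_apply_eq_zero_of_norm_eq (hw : Differentiable ℝ w) (hM : ∀ x, ‖w x‖ = M)
    (x e : EuclideanSpace ℝ (Fin 3)) : ⟪w x, fderiv ℝ w x e⟫ = 0 := by
  have hC : ∀ y, ⟪w y, w y⟫ = M ^ 2 := fun y => by rw [real_inner_self_eq_norm_sq, hM y]
  have h := inner_fderiv_add_eq_zero_of_inner_const hw hw hC x e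
  rw [real_inner_comm (w x) (fderiv ℝ w x e)] at h
  linarith

/-- **`|Dw|²_F = −⟪w, Δw⟫` for a constant-speed `C²` field.** [folklore] -/
theorem frobeniusNormSq_fderiv_eq_neg_inner_laplacian (hw : ContDiff ℝ 2 w) (hM : ∀ x, ‖w x‖ = M)
    (x : EuclideanSpace ℝ (Fin 3)) : frobeniusNormSq (fderiv ℝ w x) = -⟪w x, (Δ w) x⟫ := by
  have hw1 : Differentiable ℝ w := hw.differentiable (by norm_num)
  have hD1 : ContDiff ℝ 1 (fderiv ℝ w) := hw.fderiv_right (m := 1) le_rfl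
  rw [laplacian_eq_sum_fderiv_fderiv (EuclideanSpace.basisFun (Fin 3) ℝ) hw x,
    frobeniusNormSq_eq_sum (EuclideanSpace.basisFun (Fin 3) ℝ), inner_sum, ← Finset.sum_neg_distrib]
  refine Finset.sum_congr rfl fun i _ => ?_
  set e : EuclideanSpace ℝ (Fin 3) := EuclideanSpace.basisFun (Fin 3) ℝ i
  have hDe : Differentiable ℝ fun y => fderiv ℝ w y e :=
    (hD1.clm_apply contDiff_const).differentiable one_ne_zero
  -- differentiate `⟪w, Dw e⟫ ≡ 0` in the direction `e`
  have h := inner_fderiv_add_eq_zero_of_inner_const hw1 hDe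
    (fun y => inner_fderiv_apply_eq_zero_of_norm_eq hw1 hM y e) x e
  rw [real_inner_self_eq_norm_sq] at h
  linarith

/-- For a divergence-free `C²` field, `Δw = −curl curl w`. [folklore] -/
theorem laplacian_eq_neg_curl_curl (hw : ContDiff ℝ 2 w) (hdiv : VectorCalculus.IsDivFree w)
    (x : EuclideanSpace ℝ (Fin 3)) : (Δ w) x = -curl (curl w) x := by
  have hD : fderiv ℝ (VectorCalculus.divergence w) x = 0 := by
    have : VectorCalculus.divergence w = fun _ => (0 : ℝ) := funext hdiv
    rw [this, fderiv_const_apply]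
  rw [curl_curl_eq_sum_fderiv_divergence_sub_laplacian hw x, hD]
  simp

/-- **`|Dw|²_F = ⟪w, curl curl w⟫`** for a constant-speed divergence-free `C²` field. [folklore] -/
theorem frobeniusNormSq_fderiv_eq_inner_curl_curl (hw : ContDiff ℝ 2 w) (hdiv : VectorCalculus.IsDivFree w)
    (hM : ∀ x, ‖w x‖ = M) (x : EuclideanSpace ℝ (Fin 3)) :
    frobeniusNormSq (fderiv ℝ w x) = ⟪w x, curl (curl w) x⟫ := by
  rw [frobeniusNormSq_fderiv_eq_neg_inner_laplacian hw hM x, laplacian_eq_neg_curl_curl hw hdiv x, inner_neg_right,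
    neg_neg]

/-- **`|Dw|²_F ≤ M ‖curl curl w‖`** pointwise for a constant-speed divergence-free field (so `Dw ∈ L⁴` when
`curl ω ∈ L²`). [folklore] -/
theorem frobeniusNormSq_fderiv_le_mul_norm_curl_curl (hw : ContDiff ℝ 2 w) (hdiv : VectorCalculus.IsDivFree w)
    (hM : ∀ x, ‖w x‖ = M) (x : EuclideanSpace ℝ (Fin 3)) :
    frobeniusNormSq (fderiv ℝ w x) ≤ M * ‖curl (curl w) x‖ := by
  rw [frobeniusNormSq_fderiv_eq_inner_curl_curl hw hdiv hM x, ← hM x]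
  exact real_inner_le_norm _ _

end ExtremiserLiouville

end Summit.NavierStokesRegularity.NavierStokesRegularity.Theorems

end
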